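import Mathlib
import Literature.Computability.MetaComplexity.ZeroErrorMCSPJuntaLowerBound
import Literature.Computability.MetaComplexity.ChenJinWilliams2019.SparseTCMagnificationAtMCSP
import HarnessLib

/-!
# Zero-error hardness of sparse languages: the junta ceiling, and the known cell of
# Chen–Jin–Williams 2019, Thm. 1.9 (census rows R54 / R54-formula)

L. Chen, C. Jin, R. R. Williams, *Hardness magnification for all sparse NP languages*, FOCS 2019
(ECCC TR19-118), Thm. 1.9 (p. 6 L31–34, verbatim): "Let 𝒞 be any circuit class (e.g., 𝒞 could be
Circuit, Formula, AC⁰[6], etc.). If there is an ε > 0 and a family of languages {L_β} (indexed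
over β ∈ (0,1)) such that L_β is a 2^{n^β}-sparse NP language not solvable on average with zero
error by 𝒞-circuits of size n^ε for all β, then NP ⊄ 𝒞[n^k] for all k."  The tree's rendering of
the hypothesis is `ChenJinWilliams2019.SparseNPZEHardCircuitAt ε` / `SparseNPZEHardFormulaAt ε`
(`ZeroErrorMagnification.lean`), census rows R54 / R54-formula (`MagnificationGapCensus.gap_R54`,
`gap_R54_formula`), so far T-ONLY rows: print states no lower bound of the hypothesised kind.

This file proves two things about that hypothesis, both kernel-checked and free of named facts.

1. **The junta ceiling** (`zeSolvableFracAt_junta_of_ncard_le`,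
   `zeSolvableAt_juntaFns_of_isSparse`).
   If `q · |L ∩ {0,1}ⁿ| ≤ 2^K` then `L` IS zero-error solvable at length `n` with confidence
   `1 - 1/q` by a value/flag pair of `K`-juntas: value `≡ 0`, flag = "no YES instance agrees with
   the input on the first `K` coordinates".  This is precisely the solver of the PROOF of Thm. 1.9
   (TR19-118 p. 16 L51 – p. 17 L5: "we simply return 0 if H_t(x[1...t]) rejects, and return '?' if
   H_t(x[1...t]) accepts ... Pr[H_t(x[1...t]) accepts] ≤ 2^{n^β}/2^t ≤ 1/n", `t = n^β + log n`),
   read unconditionally: the assumption `NP ⊂ 𝒞[n^k]` is needed there only to make the flag a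
   SMALL CIRCUIT; as a JUNTA it exists outright.  Consequence: every `2^{n^β}`-sparse language is
   zero-error solvable (CJW's `Pr[?] ≤ 1/n`) by `(log₂ n + ⌈n^β⌉ + 2)`-junta pairs at every
   length, so no argument that sees only the light cones of the solver — the method behind EVERY
   known cell of this census — can certify the hypothesis of Thm. 1.9 at any `ε > β`; the
   `β`-uniform `ε` the theorem needs is outside the reach of the method, not merely of current
   proofs.  (A statement about juntas: the flag has large circuit complexity in general, and
   nothing is claimed here about `n^ε`-size circuits for `ε > β`.)

2. **The known cell, same model** (`exists_sparseNP_not_zeSolvable_below`,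
   `sparseNPZEHard_circuit_matrix_of_lt`, `sparseNPZEHard_formula_matrix_of_lt`).  For every
   `β ∈ (0,1)` the tree's dyadic family `L_β = MCSP[2^{⌊m/2^{j(β)}⌋}] ∩ {x : |x| ≥ 2^{m₀(β)}}`
   (`SparseTCMagnificationAtMCSP.lean`: `MCSPSize_mcspDyadic_mem_NP`, the proved eventual sparsity
   `mcspFamilyEventuallySparse_dyadic`, and the length restriction of `sparseNPTCHardAt_of_MCSP`)
   is in `NP`, is `2^{n^β}`-sparse at EVERY length, and for every `0 ≤ ε < 2^{-j(β)}` — a range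
   containing `[0, β/8]` (`beta_div_eight_lt`) — and every `c` is NOT zero-error solvable at any
   large power-of-two length by `B₂`-circuits with `c⌈N^ε⌉ + c` gates, nor by De Morgan formulas
   with `c⌈N^ε⌉ + c` leaves (juntas again: `not_ZESolvableFracAt_MCSPSize_of_junta` of
   `ZeroErrorMCSPJuntaLowerBound.lean`, with the budget inequality
   `eventually_sublinearBound_le_dyadicSize` and the count
   `eventually_circuitCount_lt_two_pow_sub`).
   Hence the MATRIX of `SparseNPZEHardCircuitAt ε` holds at every `β` for every `ε ≤ β/8`:
   NEEDED is `∃ ε > 0 ∀ β ∈ (0,1) ∃ L_β …`, KNOWN is `∀ β ∈ (0,1) ∀ ε ≤ β/8 ∃ L_β …` — the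
   same-model gap of row R54 is the ORDER OF TWO QUANTIFIERS, and item 1 says the light-cone
   method cannot invert them.

Sources.  [ChenJinWilliams2019] TR19-118, Thm. 1.9 (p. 6 L31–34) and its proof (p. 16 L40 – p. 17
L5), held text `paper:url-28b8c177f29e`; census rows: `MagnificationGapCensus.gap_R54`,
`gap_R54_formula` ("T-ONLY ROW (no K cell)").  [KabanetsCai2000] V. Kabanets, J.-Y. Cai, *Circuit
minimization problem*, STOC 2000, §2 (`MCSP ∈ NP`; in-tree `MCSP_mem_NP_holds`).  Everything else
is counting ([Jukna2012] S. Jukna, *Boolean Function Complexity*, Springer 2012, §1.1).  No `def`,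
no named fact, no proof placeholder; all sizes are the census's (`B₂` gates `Circuit.size`, De
Morgan leaves `leafSize`), all notions the rows' own (`ZESolvableAt`, `IsSparse (expSparsity β)`,
`NP`, `sublinearBound ε c`).
-/

open Finset Filter Topology

namespace Literature.Computability.MetaComplexity.ChenJinWilliams2019

open Literature.Computability.Complexity Literature.Computability.Complexity.Circuit
open Literature.Computability.Complexity.Classes
open Literature.Computability.Complexity.Nondeterministic
open Literature.Computability.MetaComplexity
open Literature.Computability.MetaComplexity.ChenJinWilliams2020

/-! ### Cylinders: the upper count -/

/-- A cylinder over `S` (all points agreeing with `y` on `S`) has at most `2^{n - |S|}` points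
(restriction to the complement of `S` is injective on it). [folklore] -/
theorem card_filter_agree_le {n : ℕ} (S : Finset (Fin n)) (y : Fin n → Bool) :
    (univ.filter fun x : Fin n → Bool => ∀ i ∈ S, x i = y i).card ≤ 2 ^ (n - S.card) := by
  classical
  have hcard : Fintype.card ({i : Fin n // i ∉ S} → Bool) = 2 ^ (n - S.card) := by
    rw [Fintype.card_fun, Fintype.card_bool]
    congr 1
    have h1 : Fintype.card {i : Fin n // i ∉ S} = (Sᶜ).card := by
      rw [← Fintype.card_coe]
      exact Fintype.card_congr (Equiv.subtypeEquivRight fun i => by simp)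
    rw [h1, Finset.card_compl, Fintype.card_fin]
  calc (univ.filter fun x : Fin n → Bool => ∀ i ∈ S, x i = y i).card
      ≤ (univ : Finset ({i : Fin n // i ∉ S} → Bool)).card := by
        refine Finset.card_le_card_of_injOn (fun x => fun i => x i.1) (fun _ _ => mem_univ _) ?_
        intro x hx x' hx' h
        simp only [coe_filter, mem_univ, true_and, Set.mem_setOf_eq] at hx hx'
        funext i
        by_cases hi : i ∈ S
        · rw [hx i hi, hx' i hi]
        · exact congr_fun h ⟨i, hi⟩
    _ = 2 ^ (n - S.card) := by rw [card_univ, hcard]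

/-! ### The junta ceiling: sparse languages ARE zero-error solvable by small juntas -/

/-- **The junta ceiling.** If `q · |L ∩ {0,1}ⁿ| ≤ 2^K` then `L` is zero-error solvable at length
`n` with confidence `1 - 1/q` by a value/flag pair of `K`-JUNTAS: the value is the constant
`false`, the flag answers iff no YES instance agrees with the input on the first `K` coordinates
(for `n ≤ K` the exact pair `(Lₙ, true)` is used). Consequently no argument that uses of
the solver only "value and flag depend on `≤ K` coordinates" (light cones of `K`-gate circuits,
`K`-leaf formulas) can establish zero-error hardness of a language with `q|Lₙ| ≤ 2^K`.  The pair
is the solver of CJW19's proof of Thm. 1.9 with the oracle `H_t` read as a junta.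
[cite: ChenJinWilliams2019, proof of Thm. 1.9 (TR19-118 p. 16 L51 – p. 17 L5)] -/
theorem zeSolvableFracAt_junta_of_ncard_le {q n K : ℕ} {L : Language Bool}
    (hM : q * {x : List Bool | x ∈ L ∧ x.length = n}.ncard ≤ 2 ^ K) :
    OliveiraSanthanam2018.ZESolvableFracAt q
      (fun N => {f : (Fin N → Bool) → Bool |
        ∃ S : Finset (Fin N), S.card ≤ K ∧ ∀ x x' : Fin N → Bool,
          (∀ i ∈ S, x i = x' i) → f x = f x'}) L n := by
  classical
  by_cases hKn : n ≤ K
  · -- the exact pair: value = the slice itself (an `n`-junta), flag = `true`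
    refine ⟨sliceFn L n, ⟨univ, by simpa using hKn, fun x x' h => ?_⟩, fun _ => true,
      ⟨∅, by simp, fun _ _ _ => rfl⟩, fun _ _ => rfl, ?_⟩
    · rw [show x = x' from funext fun i => h i (mem_univ i)]
    · simp
  push Not at hKn
  -- the first `K` coordinates
  set S : Finset (Fin n) := univ.map (Fin.castLEEmb hKn.le) with hSdef
  have hS : S.card = K := by simp [hSdef]
  -- the YES instances of the slice
  set T : Finset (Fin n → Bool) := univ.filter fun y => sliceFn L n y = true with hTdef
  have hTcard : T.card ≤ {x : List Bool | x ∈ L ∧ x.length = n}.ncard := by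
    have hinj : Set.InjOn (fun y : Fin n → Bool => List.ofFn y) ↑T :=
      fun y _ y' _ h => List.ofFn_injective h
    rw [← Finset.card_image_of_injOn hinj, ← Set.ncard_coe_finset]
    refine Set.ncard_le_ncard (fun w hw => ?_) (Literature.Barriers.PneNP.finite_slice _ _)
    rw [Finset.mem_coe, Finset.mem_image] at hw
    obtain ⟨y, hy, rfl⟩ := hw
    rw [hTdef, mem_filter] at hy
    exact ⟨(Set.mem_iff_boolIndicator _ _).2 hy.2, List.length_ofFn⟩
  refine ⟨fun _ => false, ⟨∅, by simp, fun _ _ _ => rfl⟩,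
    fun x => decide (∀ y ∈ T, ¬ ∀ i ∈ S, y i = x i), ⟨S, hS.le, fun x x' h => ?_⟩, ?_, ?_⟩
  · -- the flag is an `S`-junta
    have hiff : ∀ y : Fin n → Bool, (∀ i ∈ S, y i = x i) ↔ ∀ i ∈ S, y i = x' i :=
      fun y => forall₂_congr fun i hi => by rw [h i hi]
    simp only [hiff]
  · -- zero error: a flagged input agrees with no YES instance on `S`, so it is a NO instance
    intro x hx
    rw [decide_eq_true_eq] at hx
    by_contra hne
    have hxT : x ∈ T := by
      rw [hTdef, mem_filter]
      refine ⟨mem_univ _, ?_⟩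
      cases hsl : sliceFn L n x
      · exact absurd hsl.symm hne
      · rfl
    exact hx x hxT fun i _ => rfl
  · -- the unflagged inputs lie in the union of the cylinders of the YES instances over `S`
    have hsub : (univ.filter fun x : Fin n → Bool =>
        decide (∀ y ∈ T, ¬ ∀ i ∈ S, y i = x i) = false) ⊆
        T.biUnion fun y => univ.filter fun x : Fin n → Bool => ∀ i ∈ S, x i = y i := by
      intro x hx
      rw [mem_filter, decide_eq_false_iff_not] at hx
      push Not at hx
      obtain ⟨y, hy, hyx⟩ := hx.2
      exact mem_biUnion.2 ⟨y, hy, mem_filter.2 ⟨mem_univ _, fun i hi => (hyx i hi).symm⟩⟩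
    calc q * (univ.filter fun x : Fin n → Bool =>
            decide (∀ y ∈ T, ¬ ∀ i ∈ S, y i = x i) = false).card
        ≤ q * (T.card * 2 ^ (n - K)) := by
          refine Nat.mul_le_mul_left _ ((card_le_card hsub).trans ?_)
          refine card_biUnion_le.trans ?_
          rw [← smul_eq_mul, ← sum_const]
          exact sum_le_sum fun y _ => hS ▸ card_filter_agree_le S y
      _ = q * T.card * 2 ^ (n - K) := by ring
      _ ≤ 2 ^ K * 2 ^ (n - K) :=
          Nat.mul_le_mul_right _ ((Nat.mul_le_mul_left _ hTcard).trans hM)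
      _ = 2 ^ n := by rw [← pow_add]; congr 1; omega

/-- The ceiling with a length-indexed junta budget `K : ℕ → ℕ` (only `K n` matters at length `n`).
[folklore] -/
theorem zeSolvableFracAt_juntaFns_of_ncard_le {q n : ℕ} {K : ℕ → ℕ} {L : Language Bool}
    (hM : q * {x : List Bool | x ∈ L ∧ x.length = n}.ncard ≤ 2 ^ K n) :
    OliveiraSanthanam2018.ZESolvableFracAt q
      (fun N => {f : (Fin N → Bool) → Bool |
        ∃ S : Finset (Fin N), S.card ≤ K N ∧ ∀ x x' : Fin N → Bool,
          (∀ i ∈ S, x i = x' i) → f x = f x'}) L n :=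
  zeSolvableFracAt_junta_of_ncard_le hM

/-- Numerics of the ceiling for `2^{n^β}`-sparse languages in CJW's notion (`q = n`):
`n · ⌊2^{n^β}⌋ ≤ 2^{log₂ n + ⌈n^β⌉ + 2}`. [folklore] -/
theorem mul_expSparsity_le_two_pow (β : ℝ) (n : ℕ) :
    n * expSparsity β n ≤ 2 ^ (Nat.log 2 n + ⌈(n : ℝ) ^ β⌉₊ + 2) := by
  have h1 : n < 2 ^ (Nat.log 2 n + 1) := Nat.lt_pow_succ_log_self (by norm_num) n
  have h2 : expSparsity β n ≤ 2 ^ ⌈(n : ℝ) ^ β⌉₊ := by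
    unfold expSparsity
    have hR : (2 : ℝ) ^ ((n : ℝ) ^ β) ≤ ((2 ^ ⌈(n : ℝ) ^ β⌉₊ : ℕ) : ℝ) := by
      rw [Nat.cast_pow, Nat.cast_ofNat, ← Real.rpow_natCast]
      exact Real.rpow_le_rpow_of_exponent_le one_le_two (Nat.le_ceil _)
    exact Nat.floor_le_of_le hR
  calc n * expSparsity β n ≤ 2 ^ (Nat.log 2 n + 1) * 2 ^ ⌈(n : ℝ) ^ β⌉₊ :=
        Nat.mul_le_mul h1.le h2
    _ = 2 ^ (Nat.log 2 n + 1 + ⌈(n : ℝ) ^ β⌉₊) := by rw [← pow_add]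
    _ ≤ 2 ^ (Nat.log 2 n + ⌈(n : ℝ) ^ β⌉₊ + 2) := Nat.pow_le_pow_right (by norm_num) (by omega)

/-- **The junta ceiling for `2^{n^β}`-sparse languages (CJW's notion, `Pr[?] ≤ 1/n`).** Every
`2^{n^β}`-sparse language — in `NP` or not — is zero-error solvable at EVERY length `n` by a
value/flag pair of `(log₂ n + ⌈n^β⌉ + 2)`-juntas. So an argument that sees only the light cones
of the solver (as every KNOWN cell of this census does) cannot establish the hypothesis of
Thm. 1.9 at any `ε > β`: the `β`-uniform `ε` the theorem needs is out of reach of the method, not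
only of the current proofs. (This is a statement about JUNTAS; the flag used here has large
circuit complexity in general, so nothing is claimed about `n^ε`-size circuits for `ε > β`.)
[cite: ChenJinWilliams2019, proof of Thm. 1.9 (TR19-118 p. 17 L4–5, "2^{n^β}/2^t ≤ 1/n")] -/
theorem zeSolvableAt_juntaFns_of_isSparse {β : ℝ} {L : Language Bool}
    (hL : IsSparse (expSparsity β) L) (n : ℕ) :
    ZESolvableAt
      (fun N => {f : (Fin N → Bool) → Bool |
        ∃ S : Finset (Fin N), S.card ≤ Nat.log 2 N + ⌈(N : ℝ) ^ β⌉₊ + 2 ∧ ∀ x x' : Fin N → Bool,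
          (∀ i ∈ S, x i = x' i) → f x = f x'}) L n := by
  rw [OliveiraSanthanam2018.zeSolvableAt_iff_frac]
  exact zeSolvableFracAt_juntaFns_of_ncard_le (K := fun N => Nat.log 2 N + ⌈(N : ℝ) ^ β⌉₊ + 2)
    ((Nat.mul_le_mul_left _ (hL n)).trans (mul_expSparsity_le_two_pow β n))

/-! ### The hardness side: the dyadic `MCSP` family against `n^ε`-size devices, `ε < 2^{-j}` -/

/-- **Budget.** For `0 ≤ ε < 2^{-j}` and every `c`, eventually in `m`:
`(c⌈(2^m)^ε⌉ + c + 2)(m + 1) ≤ 2^{⌊m/2^j⌋} + 1` — an `O(N^ε)` budget (plus one, times the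
`log N + 1` gates of a sparse pattern) is below the dyadic threshold
`s(m) = 2^{⌊m/2^j⌋} = N^{2^{-j}}`
up to rounding (`m(24c+16)·2^{εm} ≤ 2^{(2^{-j})m}` for large `m`). [folklore] -/
theorem eventually_sublinearBound_le_dyadicSize (j c : ℕ) {ε : ℝ} (hε0 : 0 ≤ ε)
    (hε : ε < 1 / 2 ^ j) :
    ∀ᶠ m : ℕ in atTop, (sublinearBound ε c (2 ^ m) + 2) * (m + 1) ≤ dyadicSize j m + 1 := by
  set δ : ℝ := 1 / 2 ^ j - ε with hδ
  have hδ0 : 0 < δ := by rw [hδ]; linarith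
  set r : ℝ := (2 : ℝ) ^ δ with hrdef
  have hr1 : 1 < r := Real.one_lt_rpow (by norm_num) hδ0
  have hlim := tendsto_pow_const_div_const_pow_of_one_lt 1 hr1
  have hpos : (0 : ℝ) < 1 / (24 * c + 16) := by positivity
  have hev : ∀ᶠ m : ℕ in atTop, (m : ℝ) ^ 1 / r ^ m < 1 / (24 * c + 16) :=
    hlim.eventually (gt_mem_nhds hpos)
  filter_upwards [hev, eventually_ge_atTop 1] with m hm hm1
  have hrm : (0 : ℝ) < r ^ m := by positivity
  rw [pow_one, div_lt_div_iff₀ hrm (by positivity), one_mul] at hm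
  -- `hm : ↑m * (24 * ↑c + 16) < r ^ m`
  have hE : (((2 ^ m : ℕ) : ℝ)) ^ ε = (2 : ℝ) ^ (ε * m) := cast_two_pow_rpow m ε
  have hEpos : (0 : ℝ) < (2 : ℝ) ^ (ε * m) := by positivity
  have h2εm : (1 : ℝ) ≤ (2 : ℝ) ^ (ε * m) := by
    have h := Real.rpow_le_rpow_of_exponent_le (one_le_two : (1 : ℝ) ≤ 2)
      (show (0 : ℝ) ≤ ε * m by positivity)
    simpa using h
  have hceil : ((powCeil ε (2 ^ m) : ℕ) : ℝ) ≤ (2 : ℝ) ^ (ε * m) + 1 := by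
    unfold powCeil
    rw [← hE]
    exact (Nat.ceil_lt_add_one (by positivity)).le
  have hm1' : (1 : ℝ) ≤ m := by exact_mod_cast hm1
  -- the left-hand side
  have hL : (((sublinearBound ε c (2 ^ m) + 2) * (m + 1) : ℕ) : ℝ) ≤
      (12 * c + 8) * m * (2 : ℝ) ^ (ε * m) := by
    unfold sublinearBound
    push_cast
    have hc0 : (0 : ℝ) ≤ c := Nat.cast_nonneg _
    set P : ℝ := ((powCeil ε (2 ^ m) : ℕ) : ℝ) with hPdef
    set E : ℝ := (2 : ℝ) ^ (ε * m) with hEdef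
    have hA1 := mul_le_mul_of_nonneg_left hceil hc0
    have hA2 := mul_le_mul_of_nonneg_left h2εm (by positivity : (0 : ℝ) ≤ 2 * c + 2)
    have hA : (c : ℝ) * P + c + 2 ≤ (3 * c + 2) * E := by linarith
    have hB : (m : ℝ) + 1 ≤ 2 * m := by linarith
    have hC := mul_le_mul_of_nonneg_right hA (by positivity : (0 : ℝ) ≤ m + 1)
    have hD := mul_le_mul_of_nonneg_left hB (by positivity : (0 : ℝ) ≤ (3 * c + 2) * E)
    have hF : (0 : ℝ) ≤ (6 * c + 4) * m * E := by positivity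
    linarith
  -- `r^m · 2^{εm} = 2^{m/2^j}`
  have hr_pow : r ^ m * (2 : ℝ) ^ (ε * m) = (2 : ℝ) ^ ((m : ℝ) / 2 ^ j) := by
    rw [hrdef, ← Real.rpow_natCast ((2 : ℝ) ^ δ) m, ← Real.rpow_mul (by norm_num),
      ← Real.rpow_add (by norm_num)]
    congr 1
    rw [hδ]
    field_simp
    ring
  -- `2^{m/2^j} ≤ 2 · 2^{⌊m/2^j⌋}`
  have hfloor : (2 : ℝ) ^ ((m : ℝ) / 2 ^ j) ≤ 2 * ((dyadicSize j m : ℕ) : ℝ) := by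
    unfold dyadicSize
    push_cast
    have hdiv : (m : ℝ) / 2 ^ j ≤ ((m / 2 ^ j : ℕ) : ℝ) + 1 := by
      rw [div_le_iff₀ (by positivity)]
      have h1 : m < 2 ^ j * (m / 2 ^ j) + 2 ^ j := by
        have h3 := Nat.div_add_mod m (2 ^ j)
        have h4 := Nat.mod_lt m (show 0 < 2 ^ j by positivity)
        omega
      have h2 : (m : ℝ) < (2 : ℝ) ^ j * ((m / 2 ^ j : ℕ) : ℝ) + (2 : ℝ) ^ j := by
        exact_mod_cast h1
      nlinarith [h2]
    calc (2 : ℝ) ^ ((m : ℝ) / 2 ^ j) ≤ (2 : ℝ) ^ (((m / 2 ^ j : ℕ) : ℝ) + 1) :=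
          Real.rpow_le_rpow_of_exponent_le one_le_two hdiv
      _ = 2 * (2 : ℝ) ^ (m / 2 ^ j : ℕ) := by
          rw [Real.rpow_add (by norm_num), Real.rpow_natCast, Real.rpow_one]
          ring
  have key : (((sublinearBound ε c (2 ^ m) + 2) * (m + 1) : ℕ) : ℝ) ≤
      ((dyadicSize j m : ℕ) : ℝ) := by
    have h1 : (12 * c + 8) * m * (2 : ℝ) ^ (ε * m) ≤ r ^ m * (2 : ℝ) ^ (ε * m) / 2 := by
      rw [le_div_iff₀ (by norm_num : (0 : ℝ) < 2)]
      have := mul_le_mul_of_nonneg_right hm.le hEpos.le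
      nlinarith [this]
    rw [hr_pow] at h1
    linarith [hL, h1, hfloor]
  exact_mod_cast key.trans (le_add_of_nonneg_right zero_le_one)

/-- `2^{⌊m/2^j⌋} ≤ ⌈2^{m/2}⌉` for `j ≥ 1` (the dyadic threshold is in the regime of the counting
lemma `eventually_circuitCount_lt_two_pow_sub`). [folklore] -/
theorem dyadicSize_le_noBound_half {j : ℕ} (hj : 1 ≤ j) (m : ℕ) :
    dyadicSize j m ≤ OliveiraPichSanthanam2019.noBound (1 / 2) m := by
  unfold dyadicSize OliveiraPichSanthanam2019.noBound
  have h2j : 2 ≤ 2 ^ j := by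
    calc 2 = 2 ^ 1 := by norm_num
      _ ≤ 2 ^ j := Nat.pow_le_pow_right (by norm_num) hj
  have h1 : m / 2 ^ j ≤ m / 2 := Nat.div_le_div_left h2j (by norm_num)
  have hR : (((2 ^ (m / 2 ^ j) : ℕ) : ℝ)) ≤ (2 : ℝ) ^ ((1 / 2 : ℝ) * m) := by
    rw [Nat.cast_pow, Nat.cast_ofNat, ← Real.rpow_natCast]
    refine Real.rpow_le_rpow_of_exponent_le one_le_two ?_
    calc (((m / 2 ^ j : ℕ) : ℝ)) ≤ ((m / 2 : ℕ) : ℝ) := by exact_mod_cast h1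
      _ ≤ (m : ℝ) / 2 := Nat.cast_div_le
      _ = (1 / 2 : ℝ) * m := by ring
  exact_mod_cast hR.trans (Nat.le_ceil _)

/-- **Hardness of the dyadic `MCSP` family against `n^ε`-size `B₂` CIRCUITS, `ε < 2^{-j}`.** For
`j ≥ 1`, `0 ≤ ε < 2^{-j}`, every `c` and every confidence `q ≥ 2`: at all large `m`, no value/flag
pair of `B₂`-circuits with `c⌈N^ε⌉ + c` gates (`N = 2^m`) zero-error solves `MCSP[2^{⌊m/2^j⌋}]`
at length `2^m` (juntas: `not_ZESolvableFracAt_MCSPSize_of_junta`). [folklore] -/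
theorem eventually_not_ZESolvableFracAt_MCSP_dyadic_circuit {q : ℕ} (hq : 2 ≤ q) {j : ℕ}
    (hj : 1 ≤ j) (c : ℕ) {ε : ℝ} (hε0 : 0 ≤ ε) (hε : ε < 1 / 2 ^ j) :
    ∀ᶠ m : ℕ in atTop, ¬ OliveiraSanthanam2018.ZESolvableFracAt q
      (b2CircuitFns (sublinearBound ε c)) (MCSPSize (dyadicSize j)) (2 ^ m) := by
  have hcount := eventually_circuitCount_lt_two_pow_sub (s := dyadicSize j)
    (by norm_num : (0 : ℝ) ≤ 1 / 2) (by norm_num)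
    (Eventually.of_forall (dyadicSize_le_noBound_half hj))
  filter_upwards [hcount, eventually_sublinearBound_le_dyadicSize j c hε0 hε,
    eventually_ge_atTop 1] with m hc hb hm
  have hs1 : 1 ≤ dyadicSize j m := Nat.one_le_two_pow
  have hK : (sublinearBound ε c (2 ^ m) + 1) * (m + 1) ≤ dyadicSize j m + 1 :=
    le_trans (Nat.mul_le_mul_right _ (by omega)) hb
  have hKs : sublinearBound ε c (2 ^ m) + 1 ≤ dyadicSize j m := by
    have h2 : (sublinearBound ε c (2 ^ m) + 1) * 2 ≤
        (sublinearBound ε c (2 ^ m) + 1) * (m + 1) := Nat.mul_le_mul_left _ (by omega)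
    omega
  exact not_ZESolvableFracAt_MCSPSize_of_junta hq hm (b2CircuitFns_junta _ _) hs1 hK (hc _ hKs)

/-- **Hardness of the dyadic `MCSP` family against `n^ε`-leaf De Morgan FORMULAS, `ε < 2^{-j}`**
(same statement, leaves instead of gates; juntas via `deMorganFormulaFns_junta`). [folklore] -/
theorem eventually_not_ZESolvableFracAt_MCSP_dyadic_formula {q : ℕ} (hq : 2 ≤ q) {j : ℕ}
    (hj : 1 ≤ j) (c : ℕ) {ε : ℝ} (hε0 : 0 ≤ ε) (hε : ε < 1 / 2 ^ j) :
    ∀ᶠ m : ℕ in atTop, ¬ OliveiraSanthanam2018.ZESolvableFracAt q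
      (deMorganFormulaFns (sublinearBound ε c)) (MCSPSize (dyadicSize j)) (2 ^ m) := by
  have hcount := eventually_circuitCount_lt_two_pow_sub (s := dyadicSize j)
    (by norm_num : (0 : ℝ) ≤ 1 / 2) (by norm_num)
    (Eventually.of_forall (dyadicSize_le_noBound_half hj))
  filter_upwards [hcount, eventually_sublinearBound_le_dyadicSize j c hε0 hε,
    eventually_ge_atTop 1] with m hc hb hm
  have hs1 : 1 ≤ dyadicSize j m := Nat.one_le_two_pow
  have hK : sublinearBound ε c (2 ^ m) * (m + 1) ≤ dyadicSize j m + 1 :=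
    le_trans (Nat.mul_le_mul_right _ (by omega)) hb
  have hKs : sublinearBound ε c (2 ^ m) ≤ dyadicSize j m := by
    have h2 : (sublinearBound ε c (2 ^ m) + 2) * 2 ≤
        (sublinearBound ε c (2 ^ m) + 2) * (m + 1) := Nat.mul_le_mul_left _ (by omega)
    omega
  exact not_ZESolvableFracAt_MCSPSize_of_junta hq hm (deMorganFormulaFns_junta _ _) hs1 hK
    (hc _ hKs)

/-! ### The witness languages of row R54: `MCSP[2^{⌊m/2^{j(β)}⌋}]` at lengths `≥ 2^{m₀}` -/

/-- Restricting a language to lengths `≥ N₀` does not change its slices at lengths `N ≥ N₀`.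
[folklore] -/
theorem sliceFn_lengthGE_inf {L : Language Bool} {N₀ N : ℕ} (h : N₀ ≤ N) :
    sliceFn (({w : List Bool | N₀ ≤ w.length} : Language Bool) ⊓ L) N = sliceFn L N := by
  funext x
  have key : ∀ M : Language Bool, sliceFn M N x = true ↔ List.ofFn x ∈ M :=
    fun M => (Set.mem_iff_boolIndicator _ _).symm
  rw [Bool.eq_iff_iff, key, key]
  exact ⟨fun h' => h'.2,
    fun h' => ⟨show N₀ ≤ (List.ofFn x).length by rwa [List.length_ofFn], h'⟩⟩

/-- Zero-error solvability depends only on the slice. [folklore] -/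
theorem zeSolvableFracAt_congr_sliceFn {q N : ℕ} {𝒞 : ∀ n : ℕ, Set ((Fin n → Bool) → Bool)}
    {L L' : Language Bool} (h : sliceFn L N = sliceFn L' N) :
    OliveiraSanthanam2018.ZESolvableFracAt q 𝒞 L N ↔
      OliveiraSanthanam2018.ZESolvableFracAt q 𝒞 L' N := by
  unfold OliveiraSanthanam2018.ZESolvableFracAt
  rw [h]

/-- `j(β) ≥ 1` (indeed `2^{j(β)} ≥ 4/β > 4`). [folklore] -/
theorem one_le_dyadicIndex {β : ℝ} (hβ : 0 < β) (hβ1 : β < 1) : 1 ≤ dyadicIndex β := by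
  by_contra h0
  have hj : dyadicIndex β = 0 := by omega
  have h4 := four_div_le_two_pow_dyadicIndex hβ
  rw [hj, pow_zero] at h4
  have : (4 : ℝ) < 4 / β := by
    rw [lt_div_iff₀ hβ]; linarith
  linarith

/-- `2^{-j(β)} > β/8` for `β ∈ (0,1)` (`j(β) = ⌈log₂(4/β)⌉ < log₂(4/β) + 1`, so
`2^{j(β)} < 8/β`): the exponent range `[0, 2^{-j(β)})` of the hardness theorems contains
`[0, β/8]`. [folklore] -/
theorem beta_div_eight_lt {β : ℝ} (hβ : 0 < β) (hβ1 : β < 1) :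
    β / 8 < 1 / 2 ^ dyadicIndex β := by
  have hpos : 0 < 4 / β := by positivity
  have hge1 : (1 : ℝ) ≤ 4 / β := by rw [le_div_iff₀ hβ]; linarith
  have hj : ((dyadicIndex β : ℕ) : ℝ) < Real.logb 2 (4 / β) + 1 := by
    unfold dyadicIndex
    exact Nat.ceil_lt_add_one (Real.logb_nonneg one_lt_two hge1)
  have h2j : (2 : ℝ) ^ (dyadicIndex β) < 8 / β := by
    calc (2 : ℝ) ^ (dyadicIndex β) = (2 : ℝ) ^ ((dyadicIndex β : ℕ) : ℝ) :=
          (Real.rpow_natCast 2 _).symm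
      _ < (2 : ℝ) ^ (Real.logb 2 (4 / β) + 1) :=
          Real.rpow_lt_rpow_of_exponent_lt (by norm_num) hj
      _ = 4 / β * 2 := by
          rw [Real.rpow_add (by norm_num), Real.rpow_logb (by norm_num) (by norm_num) hpos,
            Real.rpow_one]
      _ = 8 / β := by ring
  have h2pos : (0 : ℝ) < 2 ^ dyadicIndex β := by positivity
  rw [div_lt_div_iff₀ (by norm_num) h2pos]
  have h3 := (lt_div_iff₀ hβ).1 h2j
  linarith

/-- "Fails at all large powers of two" implies "does not hold at all large lengths". [folklore] -/
theorem not_eventually_of_eventually_pow_not {P : ℕ → Prop}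
    (h : ∀ᶠ m : ℕ in atTop, ¬ P (2 ^ m)) : ¬ ∀ᶠ n : ℕ in atTop, P n := fun hall => by
  obtain ⟨m, h1, h2⟩ :=
    (h.and ((tendsto_pow_atTop_atTop_of_one_lt (one_lt_two : (1 : ℕ) < 2)).eventually hall)).exists
  exact h1 h2

/-- **The witness family of row R54 (both device classes).** For every `β ∈ (0,1)` the language
`L_β = MCSP[2^{⌊m/2^{j(β)}⌋}] ∩ {x : |x| ≥ 2^{m₀(β)}}` is in `NP` (`MCSPSize_mcspDyadic_mem_NP`,
`inter_P_mem_NP`), is `2^{n^β}`-sparse at EVERY length (`mcspFamilyEventuallySparse_dyadic` above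
`2^{m₀}`, empty below and off the powers of two), and for every `0 ≤ ε < 2^{-j(β)}` (a range
containing `[0, β/8]`, `beta_div_eight_lt`) and every `c` it is NOT zero-error solvable in CJW's
sense (`Pr[?] ≤ 1/N`) at any large power-of-two length — neither by `B₂`-circuits with
`c⌈N^ε⌉ + c` gates nor by De Morgan formulas with `c⌈N^ε⌉ + c` leaves. [folklore] -/
theorem exists_sparseNP_not_zeSolvable_below {β : ℝ} (hβ : 0 < β) (hβ1 : β < 1) :
    ∃ L : Language Bool, L ∈ NP ∧ IsSparse (expSparsity β) L ∧
      ∀ ε : ℝ, 0 ≤ ε → ε < 1 / 2 ^ dyadicIndex β → ∀ c : ℕ,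
        (∀ᶠ m : ℕ in atTop, ¬ ZESolvableAt (b2CircuitFns (sublinearBound ε c)) L (2 ^ m)) ∧
        (∀ᶠ m : ℕ in atTop,
          ¬ ZESolvableAt (deMorganFormulaFns (sublinearBound ε c)) L (2 ^ m)) := by
  obtain ⟨m₀, hm₀⟩ := eventually_atTop.1 (mcspFamilyEventuallySparse_dyadic β hβ hβ1)
  set L : Language Bool :=
    ({x : List Bool | 2 ^ m₀ ≤ x.length} : Language Bool) ⊓ MCSPSize (mcspDyadic β) with hLdef
  have hj := one_le_dyadicIndex hβ hβ1
  -- transfer of non-solvability from `MCSP[s]` to `L` at lengths `2^m ≥ 2^{m₀}`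
  have htransfer : ∀ {𝒞 : ∀ n : ℕ, Set ((Fin n → Bool) → Bool)} {m : ℕ}, m₀ ≤ m → 1 ≤ m →
      ¬ OliveiraSanthanam2018.ZESolvableFracAt 2 𝒞 (MCSPSize (mcspDyadic β)) (2 ^ m) →
      ¬ ZESolvableAt 𝒞 L (2 ^ m) := by
    intro 𝒞 m hmm₀ hm1 hnot hsolv
    have h2 : 2 ≤ 2 ^ m :=
      calc 2 = 2 ^ 1 := (pow_one 2).symm
        _ ≤ 2 ^ m := Nat.pow_le_pow_right (by norm_num) hm1
    have hfrac := OliveiraSanthanam2018.ZESolvableFracAt.of_zeSolvableAt hsolv h2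
    rw [hLdef, zeSolvableFracAt_congr_sliceFn
      (sliceFn_lengthGE_inf (Nat.pow_le_pow_right (by norm_num) hmm₀))] at hfrac
    exact hnot hfrac
  refine ⟨L, Literature.Algebra.EuclideanLattices.inter_P_mem_NP (setOf_le_length_mem_P _)
    (MCSPSize_mcspDyadic_mem_NP β), fun N => ?_, fun ε hε0 hε c => ⟨?_, ?_⟩⟩
  · -- sparsity at every length
    have hsub : {x : List Bool | x ∈ L ∧ x.length = N} ⊆
        {x : List Bool | x ∈ MCSPSize (mcspDyadic β) ∧ x.length = N} :=
      fun x hx => ⟨hx.1.2, hx.2⟩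
    by_cases hpow : ∃ m : ℕ, N = 2 ^ m
    · obtain ⟨m, rfl⟩ := hpow
      by_cases hm : m₀ ≤ m
      · exact (Set.ncard_le_ncard hsub (Literature.Barriers.PneNP.finite_slice _ _)).trans
          (hm₀ m hm)
      · have hempty : {x : List Bool | x ∈ L ∧ x.length = 2 ^ m} = ∅ := by
          ext x
          simp only [Set.mem_setOf_eq, Set.mem_empty_iff_false, iff_false, not_and]
          intro hx hlen
          have h1 : 2 ^ m₀ ≤ x.length := hx.1
          rw [hlen] at h1
          exact hm ((Nat.pow_le_pow_iff_right (le_refl 2)).1 h1)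
        rw [hempty, Set.ncard_empty]
        exact Nat.zero_le _
    · push Not at hpow
      have hempty : {x : List Bool | x ∈ L ∧ x.length = N} = ∅ :=
        Set.eq_empty_of_subset_empty
          (hsub.trans (slice_MCSPSize_eq_empty (s := mcspDyadic β) hpow).subset)
      rw [hempty, Set.ncard_empty]
      exact Nat.zero_le _
  · filter_upwards [eventually_not_ZESolvableFracAt_MCSP_dyadic_circuit (le_refl 2) hj c hε0 hε,
      eventually_ge_atTop m₀, eventually_ge_atTop 1] with m hm hmm₀ hm1
    exact htransfer hmm₀ hm1 hm
  · filter_upwards [eventually_not_ZESolvableFracAt_MCSP_dyadic_formula (le_refl 2) hj c hε0 hε,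
      eventually_ge_atTop m₀, eventually_ge_atTop 1] with m hm hmm₀ hm1
    exact htransfer hmm₀ hm1 hm

/-- **Row R54 (`𝒞 = Circuit`), the KNOWN cell in the row's own vocabulary.** For every
`β ∈ (0,1)` and every `0 ≤ ε < 2^{-j(β)}` (so every `ε ≤ β/8`), the matrix of the hypothesis
`SparseNPZEHardCircuitAt ε` of Thm. 1.9 holds AT THIS `β`: some `2^{n^β}`-sparse `NP` language is
not zero-error solvable by `B₂`-circuits of `c⌈n^ε⌉ + c` gates at all large lengths, for every
`c`. What Thm. 1.9 NEEDS is ONE `ε > 0` serving EVERY `β ∈ (0,1)`; what is KNOWN (here, by light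
cones) is an `ε` that shrinks with `β` — and by the junta ceiling
`zeSolvableAt_juntaFns_of_isSparse`
no light-cone argument gives more than `ε ≤ β`.
[cite: ChenJinWilliams2019, Thm. 1.9 (hypothesis, 𝒞 = Circuit), TR19-118 p. 6 L31–34] -/
theorem sparseNPZEHard_circuit_matrix_of_lt {β : ℝ} (hβ : 0 < β) (hβ1 : β < 1) {ε : ℝ}
    (hε0 : 0 ≤ ε) (hε : ε < 1 / 2 ^ dyadicIndex β) :
    ∃ L : Language Bool, L ∈ NP ∧ IsSparse (expSparsity β) L ∧
      ∀ c : ℕ, ¬ ∀ᶠ n in atTop, ZESolvableAt (b2CircuitFns (sublinearBound ε c)) L n := by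
  obtain ⟨L, hNP, hsp, h⟩ := exists_sparseNP_not_zeSolvable_below hβ hβ1
  exact ⟨L, hNP, hsp, fun c => not_eventually_of_eventually_pow_not (h ε hε0 hε c).1⟩

/-- **Row R54-formula (`𝒞 = Formula`, De Morgan leaves), the KNOWN cell**: the matrix of
`SparseNPZEHardFormulaAt ε` at every `β ∈ (0,1)`, for every `0 ≤ ε < 2^{-j(β)}`.
[cite: ChenJinWilliams2019, Thm. 1.9 (hypothesis, 𝒞 = Formula), TR19-118 p. 6 L31–34] -/
theorem sparseNPZEHard_formula_matrix_of_lt {β : ℝ} (hβ : 0 < β) (hβ1 : β < 1) {ε : ℝ}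
    (hε0 : 0 ≤ ε) (hε : ε < 1 / 2 ^ dyadicIndex β) :
    ∃ L : Language Bool, L ∈ NP ∧ IsSparse (expSparsity β) L ∧
      ∀ c : ℕ, ¬ ∀ᶠ n in atTop,
        ZESolvableAt (deMorganFormulaFns (sublinearBound ε c)) L n := by
  obtain ⟨L, hNP, hsp, h⟩ := exists_sparseNP_not_zeSolvable_below hβ hβ1
  exact ⟨L, hNP, hsp, fun c => not_eventually_of_eventually_pow_not (h ε hε0 hε c).2⟩

/-- The same cells with the exponent range stated as `ε ≤ β/8`. [folklore] -/
theorem sparseNPZEHard_circuit_matrix_of_le_div_eight {β : ℝ} (hβ : 0 < β) (hβ1 : β < 1)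
    {ε : ℝ} (hε0 : 0 ≤ ε) (hε : ε ≤ β / 8) :
    ∃ L : Language Bool, L ∈ NP ∧ IsSparse (expSparsity β) L ∧
      ∀ c : ℕ, ¬ ∀ᶠ n in atTop, ZESolvableAt (b2CircuitFns (sublinearBound ε c)) L n :=
  sparseNPZEHard_circuit_matrix_of_lt hβ hβ1 hε0 (hε.trans_lt (beta_div_eight_lt hβ hβ1))

end Literature.Computability.MetaComplexity.ChenJinWilliams2019
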